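import Literature.MathematicalPhysics.QuantumFieldTheory.Balaban1983to89.B7Prop1Explicit

/-!
# NE7BlockAverageContourGaugeZd — H-1″ on `ℤ^d`, LITERALLY for the tree's own linearisation `B7Prop1Explicit.Tside` of
# Bałaban's average (42): `T_c = Σ_{x∈B(c₋)} L^{−d} A(Γ_{c,x})` is the straight-stencil average plus the coarse gradient of the
# TREE POTENTIAL (an exact coarse pure gauge); its linearised coarse plaquettes are the block means of the `L × L` Wilson loops
# — identical to those of the straight average; pure gauges are averaged to RESTRICTED pure gauges

Cell `pub-balaban`, rung (B)+1 sub-cell t4, lineage `b2b-balaban-t4-ne7-p2` (CRUX PROVER NE7 #2, coordinator ruling «YM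
redirect», 2026-08-21; generation 51; texts `HOME/t4/b2b-balaban-t4-ne7-p2/g51/HOM-JUNCTION-NE7-P2.md` v3 §2″).  Companion of
`NE7BlockAverageContourGauge` (the same statements on the typed torus for an ARBITRARY corner-transporter system, docked to
`B5Block118.QvOp` and `T4AveragingDeficit.deficit` by name).  THIS file is about the `ℤ^d` word calculus of `B7Prop1Explicit`
and its declared linearisation `Tside` ((47)–(48) p. 25; `AbelianBlockAverage.bavg_expUnit'`: in a commutative algebra the
average (42) IS `exp (Tside)`), i.e. about B7's contour `gammaWord L κ r = treeWord r ++ seg κ L ++ revWord (treeWord r)` —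
«the last piece is `Γ_{c₊,x(c)}` reversed» — with the B5 (1.7) trees, the object of the cell's computation
`balaban-calc/notes/NE7-P-HOM-1.md` («Q = B7 (14)∕(15)∕(42) linearised abelian with B5 (1.7) tree contours, last piece REVERSED
exactly as kernel-formalised in `B7Prop1Explicit.gammaWord`; normalisation `L^{−d}` (`Q̂(0) = L·Id`)»).

HONEST FRAMING (T4-DAG PAGE 1).  The cell's T⁴ target is the finite-torus continuum limit of Bałaban's unit-scale averaged
loop expectations — NOT infinite volume, NO mass gap, NOT the Clay problem, NOT summit progress.  [folklore] bookkeeping of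
formal sums in an arbitrary normed ring; nothing non-linear, nothing of NE7 (NOT printed, NOT proved; spine 0∕9).
HONEST DEPENDENCY (cell, verbatim): continuum YM on T⁴ ⇐ BetaPertH ∧ nine spine estimates (0/9 proved); BetaPertH ⇐ (D1) ∧
(D4) ∧ CAP+tail; G-an2-4 gates asym, D1 and NE2/3/4.

CITATION HEADER (lean-in-tree rule 2026-08-18).  No sentence of any paper is a hypothesis; `[cite:]` tags locate OBJECTS.
T. Bałaban, *Averaging operations for lattice gauge theories*, Commun. Math. Phys. **98** (1985) 17–51 [Balaban1985Averaging]
(«B7»): (14) p. 19, (42) p. 23, (45) p. 24, (47)–(48) p. 25 (quoted in full in the header of `B7Prop1Explicit`); T. Bałaban,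
*Propagators and renormalization transformations for lattice gauge theories. I*, Commun. Math. Phys. **95** (1984) 17–40
[Balaban1984PropagatorsI] («B5»): (1.7) p. 18 the trees, (1.11) p. 19 «`(QA)_c = Σ_{x∈B(c₋)} L^{−(d+1)}A([x, x(c)])`», (1.13)
p. 19 «`B^λ_c = B_c − (∂Q′λ)(c)`».
[cite: Balaban1985Averaging, (14) p. 19, (42) p. 23, (45) p. 24, (47)–(48) p. 25; Balaban1984PropagatorsI, (1.7) p. 18, (1.11),
(1.13) p. 19 (objects only)]

WHAT IS TYPED AND PROVED (all [folklore]; `𝔸` any normed ring that is a normed `ℂ`-algebra, as for `Tside`; `c = ⟨q, q + Le_κ⟩`,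
`B(q) = {q + r : r ∈ [0,L)^d}`).
* `Qstraight L A q κ = Σ_r L^{−d}·A([q+r, q+r+Le_κ])` — B5 (1.11) with B7's normalisation (`= L·(QA)_c`); `treePot L A q =
  Σ_r L^{−d}·A(Γ_{q,q+r})` — the block mean of the tree transporters.
* **`Tside_eq`**: `Tside L A q κ = Qstraight L A q κ + (treePot L A q − treePot L A (q + Le_κ))` — (14) summed over the block:
  THE CONTOUR PART OF B7's LINEARISED AVERAGE IS THE COARSE GRADIENT OF THE TREE POTENTIAL (tree `asum_gammaWord`).
* `cplaqLin L T z μ ν = T(z,μ) + T(z+Le_μ,ν) − T(z+Le_ν,μ) − T(z,ν)` (the abelian `cplaq`); `cplaqLin_coarseGrad` (= 0 on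
  coarse gradients); **`cplaqLin_Tside`**: `cplaqLin L (Tside L A) z μ ν = Σ_r L^{−d}·A(∂(p′)_{z+r})` (tree
  `corner_cancellation` summed) `= Σ_r L^{−d}·Σ_{i,j<L} A(∂p_{z+r+ie_μ+je_ν})` (`cplaqLin_Tside_eq_blockMean`, tree `stokes`) —
  (48) p. 25 as a statement about `Tside`; **`cplaqLin_Tside_eq_Qstraight`**: the same for the straight average, hence EVERY
  function of the linearised coarse plaquette field (Wilson forms, the K2a defect Δ1) agrees on `Tside` and on `Qstraight`
  (`comp_cplaqLin_Tside`).
* Pure gauges: `asum_grad` (`(dλ)(Γ) = λ(end) − λ(start)` along every word), **`Tside_grad`**: `Tside L (dλ) q κ = λ(q + Le_κ) −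
  λ(q)` — the tree-contour average maps a fine pure gauge to the coarse pure gauge of the RESTRICTED `λ` ((45)∕(11) linearised),
  while **`Qstraight_grad`**: `= Σ_r L^{−d}(λ(q+r+Le_κ) − λ(q+r))`, the block MEAN ((1.13) `∂Q′λ`).
NOT HERE: the torus (companion file), the non-linear average, anything of NE7.
-/

noncomputable section

open scoped BigOperators
open Finset

namespace Summit.QuantumFields.BalabanUV.T4Continuum.NE7BlockAverageContourGaugeZd

open Literature.MathematicalPhysics.QuantumFieldTheory.Balaban1983to89
open Literature.MathematicalPhysics.QuantumFieldTheory.Balaban1983to89.B7Prop1Explicit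

variable {d : ℕ} {𝔸 : Type*} [NormedRing 𝔸]

/-! ## §1 The straight part and the tree potential; `Tside = Qstraight − δ(treePot)` -/

section Decomposition

variable [NormedAlgebra ℂ 𝔸] (L : ℕ)

/-- The STRAIGHT part of B7's linearised average with B7's normalisation: `Σ_{x∈B(c₋)} L^{−d} A([x, x(c)])` for
`c = ⟨q, q + Le_κ⟩` — B5 (1.11) «`(QA)_c = Σ_{x∈B(c₋)} L^{−(d+1)}A([x, x(c)])`» times `L`.
[cite: Balaban1984PropagatorsI, (1.11) p.19] -/
def Qstraight (A : Site d → Fin d → 𝔸) (q : Site d) (κ : Fin d) : 𝔸 :=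
  ∑ r : Fin d → Fin L, (((L : ℝ) ^ d)⁻¹) • asum A (q + boxVec L r) (seg κ L)

/-- The TREE POTENTIAL `Φ(q) = Σ_{x∈B(q)} L^{−d} A(Γ_{q,x})`: block mean of the linearised transporters along the B5 (1.7) trees
from the block corner. [cite: Balaban1984PropagatorsI, (1.7) p.18] -/
def treePot (A : Site d → Fin d → 𝔸) (q : Site d) : 𝔸 :=
  ∑ r : Fin d → Fin L, (((L : ℝ) ^ d)⁻¹) • asum A q (treeWord (boxVec L r))

/-- **B7's linearised contour average is the straight average plus an exact coarse pure gauge**: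
`T_c = Σ_x L^{−d}A(Γ_{c,x}) = Qstraight + (Φ(c₋) − Φ(c₊))`, `Φ` the tree potential ((14): `A(Γ_{c,x}) = A(Γ_{c₋,x}) +
A([x,x(c)]) − A(Γ_{c₊,x(c)})`, tree `asum_gammaWord`, summed over the block). [cite: Balaban1985Averaging, (14) p.19, (47) p.25] -/
theorem Tside_eq (A : Site d → Fin d → 𝔸) (q : Site d) (κ : Fin d) :
    Tside L A q κ = Qstraight L A q κ + (treePot L A q - treePot L A (q + (L : ℤ) • e κ)) := by
  unfold Tside Qstraight treePot
  rw [← Finset.sum_sub_distrib, ← Finset.sum_add_distrib]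
  refine Finset.sum_congr rfl fun r _ => ?_
  rw [asum_gammaWord, ← smul_sub, ← smul_add]
  congr 1
  abel

omit [NormedAlgebra ℂ 𝔸] in
/-- On a fine PURE GAUGE `A_b = λ(b₊) − λ(b₋)` the path functional telescopes: `A(Γ) = λ(x + disp Γ) − λ(x)`. [folklore] -/
theorem asum_grad (f : Site d → 𝔸) : ∀ (x : Site d) (w : List (Letter d)),
    asum (fun y μ => f (y + e μ) - f y) x w = f (x + disp w) - f x
  | x, [] => by simp
  | x, l :: w => by
    rw [asum_cons, asum_grad f (x + l.vec) w, disp_cons, ← add_assoc]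
    have hstep : stepA (fun y μ => f (y + e μ) - f y) x l = f (x + l.vec) - f x := by
      obtain ⟨μ, b⟩ := l
      cases b
      · simp only [stepA, Letter.vec, Bool.false_eq_true, ↓reduceIte, neg_sub]
        rw [show x + -e μ + e μ = x by abel]
      · simp [stepA, Letter.vec]
    rw [hstep]
    abel

/-- **RESTRICTION COVARIANCE ((45)∕(11) linearised)**: the tree-contour average of the fine pure gauge `dλ` is the coarse pure
gauge of `λ` RESTRICTED to the `L`-lattice: `T_c(dλ) = λ(c₊) − λ(c₋)` (every contour `Γ_{c,x}` runs from `c₋` to `c₊`).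
[cite: Balaban1985Averaging, (45) p.24, (11) p.19] -/
theorem Tside_grad (hL : 1 ≤ L) (f : Site d → 𝔸) (q : Site d) (κ : Fin d) :
    Tside L (fun y μ => f (y + e μ) - f y) q κ = f (q + (L : ℤ) • e κ) - f q := by
  unfold Tside
  simp_rw [asum_grad, disp_gammaWord]
  rw [← Finset.sum_smul, sum_weights L hL, one_smul]

/-- … whereas the STRAIGHT average of `dλ` is the coarse gradient of the block MEAN of `λ` (B5 (1.13) `B − ∂Q′λ`):
`Qstraight L (dλ) q κ = Σ_r L^{−d}(λ(q + r + Le_κ) − λ(q + r))`. [cite: Balaban1984PropagatorsI, (1.13) p.19] -/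
theorem Qstraight_grad (f : Site d → 𝔸) (q : Site d) (κ : Fin d) :
    Qstraight L (fun y μ => f (y + e μ) - f y) q κ
      = ∑ r : Fin d → Fin L, (((L : ℝ) ^ d)⁻¹) • (f (q + boxVec L r + (L : ℤ) • e κ) - f (q + boxVec L r)) := by
  unfold Qstraight
  simp_rw [asum_grad, disp_seg]

end Decomposition

/-! ## §2 Linearised coarse plaquettes: the contour parts cancel, block means of Wilson loops remain -/

section Plaquettes

variable (L : ℕ)

/-- The LINEARISED coarse plaquette variable of an `L`-lattice bond function `T` (abelian form of `B7Prop1Explicit.cplaq`):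
`T(z,μ) + T(z + Le_μ, ν) − T(z + Le_ν, μ) − T(z, ν)`. [cite: Balaban1985Averaging, (44) p.24] -/
def cplaqLin (T : Site d → Fin d → 𝔸) (z : Site d) (μ ν : Fin d) : 𝔸 :=
  T z μ + T (z + (L : ℤ) • e μ) ν - T (z + (L : ℤ) • e ν) μ - T z ν

/-- A coarse pure gauge has no plaquettes: `cplaqLin (q κ ↦ Φ(q) − Φ(q + Le_κ)) = 0`. [folklore] -/
theorem cplaqLin_coarseGrad (Φ : Site d → 𝔸) (z : Site d) (μ ν : Fin d) :
    cplaqLin L (fun q κ => Φ q - Φ (q + (L : ℤ) • e κ)) z μ ν = 0 := by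
  simp only [cplaqLin]
  rw [add_right_comm z ((L : ℤ) • e ν) ((L : ℤ) • e μ)]
  abel

/-- `cplaqLin` is additive in the bond function. [folklore] -/
theorem cplaqLin_add (T T' : Site d → Fin d → 𝔸) (z : Site d) (μ ν : Fin d) :
    cplaqLin L (fun q κ => T q κ + T' q κ) z μ ν = cplaqLin L T z μ ν + cplaqLin L T' z μ ν := by
  simp only [cplaqLin]
  abel

variable [NormedAlgebra ℂ 𝔸]

/-- **(48) for `Tside`**: the linearised coarse plaquette of B7's average is the block mean of the `L × L` Wilson loops,
`cplaqLin L (Tside L A) z μ ν = Σ_r L^{−d}·A(∂(p′)_{z+r})` — the tree parts cancel around `∂p′` (tree `corner_cancellation`,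
summed over the block). [cite: Balaban1985Averaging, (48) p.25] -/
theorem cplaqLin_Tside (A : Site d → Fin d → 𝔸) (z : Site d) (μ ν : Fin d) :
    cplaqLin L (Tside L A) z μ ν
      = ∑ r : Fin d → Fin L, (((L : ℝ) ^ d)⁻¹) • asum A (z + boxVec L r) (rectWord L L μ ν) := by
  simp only [cplaqLin, Tside, ← Finset.sum_add_distrib, ← Finset.sum_sub_distrib, ← smul_add, ← smul_sub,
    corner_cancellation]

/-- **(48), second equality, for `Tside`**: `= Σ_r L^{−d}·Σ_{i,j<L} A(∂p_{z+r+ie_μ+je_ν})` — the block mean of the sums of the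
`L²` fine plaquette variables (tree `stokes`). [cite: Balaban1985Averaging, (48) p.25] -/
theorem cplaqLin_Tside_eq_blockMean (A : Site d → Fin d → 𝔸) (z : Site d) (μ ν : Fin d) :
    cplaqLin L (Tside L A) z μ ν
      = ∑ r : Fin d → Fin L, (((L : ℝ) ^ d)⁻¹) •
          ∑ i ∈ Finset.range L, ∑ j ∈ Finset.range L,
            asum A (z + boxVec L r + (i : ℤ) • e μ + (j : ℤ) • e ν) (plaqWord μ ν) := by
  rw [cplaqLin_Tside]
  simp_rw [stokes]

/-- The same block mean for the STRAIGHT average (tree `asum_rectWord`). [cite: Balaban1984PropagatorsI, (1.11) p.19] -/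
theorem cplaqLin_Qstraight (A : Site d → Fin d → 𝔸) (z : Site d) (μ ν : Fin d) :
    cplaqLin L (Qstraight L A) z μ ν
      = ∑ r : Fin d → Fin L, (((L : ℝ) ^ d)⁻¹) • asum A (z + boxVec L r) (rectWord L L μ ν) := by
  simp only [cplaqLin, Qstraight, ← Finset.sum_add_distrib, ← Finset.sum_sub_distrib, ← smul_add, ← smul_sub,
    asum_rectWord]
  refine Finset.sum_congr rfl fun r _ => ?_
  rw [show z + (L : ℤ) • e μ + boxVec L r = z + boxVec L r + (L : ℤ) • e μ by abel,
    show z + (L : ℤ) • e ν + boxVec L r = z + boxVec L r + (L : ℤ) • e ν by abel]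

/-- **THE CONTOUR PARTS DROP OUT OF EVERY COARSE PLAQUETTE**: `cplaqLin L (Tside L A) = cplaqLin L (Qstraight L A)`.
[cite: Balaban1985Averaging, (48) p.25] -/
theorem cplaqLin_Tside_eq_Qstraight (A : Site d → Fin d → 𝔸) (z : Site d) (μ ν : Fin d) :
    cplaqLin L (Tside L A) z μ ν = cplaqLin L (Qstraight L A) z μ ν := by
  rw [cplaqLin_Tside, cplaqLin_Qstraight]

/-- As plaquette FIELDS: `cplaqLin L (Tside L A) = cplaqLin L (Qstraight L A)`; hence every function of the linearised coarse
plaquette field — Wilson forms on any window, the K2a defect `Δ1` of the cell's computation — takes the same value on B7's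
contour average and on the straight one. [folklore] -/
theorem comp_cplaqLin_Tside {β : Sort*} (F : (Site d → Fin d → Fin d → 𝔸) → β) (A : Site d → Fin d → 𝔸) :
    F (cplaqLin L (Tside L A)) = F (cplaqLin L (Qstraight L A)) := by
  congr 1
  funext z μ ν
  exact cplaqLin_Tside_eq_Qstraight L A z μ ν

end Plaquettes

end Summit.QuantumFields.BalabanUV.T4Continuum.NE7BlockAverageContourGaugeZd

end
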